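import Literature.Probability.LatticeModels.SRWKilledWalkFunctionals
import Literature.Probability.LatticeModels.HoleFreePotential
import Literature.Probability.RandomPlanarGeometry.ChordalLERWScalingLimit
import Mathlib.NumberTheory.Harmonic.EulerMascheroni
import HarnessLib

/-!
# The Green's function at the centre of a simply connected lattice domain against the conformal radius (Kozdron–Lawler 2005, Thm. 1.2)

Topic `Literature/Probability/LatticeModels` (discrete potential theory on `ℤ²`; companions
`SRWKilledWalkFunctionals.lean` — the killed Green function `SRW.killedGreen`, `HoleFreePotential.lean`
— hole-free (= simply connected) lattice sets, `WeakBeurlingEstimate.lean`, `LatticeHarnackOneScale.lean`).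

M. J. Kozdron, G. F. Lawler, *Estimates of random walk exit probabilities and application to
loop-erased random walk*, Electron. J. Probab. 10 (2005), 1442–1467 (arXiv:math/0501189), §1.1 and
Theorem 1.2, first display:

> "Let `𝒜` denote the set of finite, simply connected subsets of `ℤ²` containing the origin … to each
> `A ∈ 𝒜` we associate the simply connected domain `Ã ⊂ ℂ` obtained by identifying each lattice
> point with the square of side one centred at that point … `f_A` the conformal transformation of `Ã`
> onto the unit disc with `f_A(0) = 0`, `f_A'(0) > 0` … `inrad(A) = min{|z| : z ∈ ℤ² ∖ A}` and `𝒜ⁿ`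
> the set of `A ∈ 𝒜` with `n ≤ inrad(A) ≤ 2n` … **Theorem 1.2.** If `A ∈ 𝒜ⁿ`, then
> `G_A(0) = -(2/π) log f_A'(0) + k₀ + O(n^{-1/3} log n)`",

where `G_A(x) = G_A(x, x)`, `G_A(x, y) = E^x[Σ_{j < τ_A} 𝟙{S_j = y}]` is the Green's function of simple
random walk killed on exiting `A` (§2.3), `k₀ = (2ς + 3 log 2)/π` with `ς` Euler's constant is the
constant of the potential kernel `a(x) = (2/π) log|x| + k₀ + o(1)` (§2.3), and "we write `O(·)` for
uniform error terms that depend only on `n`" (§1.1).  (The `log` in front of `f_A'(0)`, dropped in one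
display of the arXiv text, is forced by the proof in §3.2: `G_A = (2/π) g_A + k + O(n^{-1/3} log n)` with
`g_A = -log|f_A|`.)  Since `1/f_A'(0)` is the conformal radius of `Ã` seen from `0`, the theorem says:
the expected number of visits to the centre equals `(2/π) log(conformal radius) + k₀` up to an error
that is uniform over ALL simply connected lattice domains of comparable inradius — no smoothness of
the boundary is assumed.  This is the lattice-potential-theory input of every "Green function
observable" identification of a planar scaling limit (LERW: Lawler–Schramm–Werner 2004 and
Lawler–Viklund 2021; the SAW route `SAWRenewalTightness`, crux `SubseqIdentification`, line
`room-entropy-wright-fisher`, stub `stub_roomMartingaleLimit`, which is blocked on it).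

This file only STATES the theorem as a named fact (`def … : Prop`), in the tree's vocabulary:
the killed walk is `SRW.killedGreen (ChordalLERW.siteGraph A)` (walk on the sites of `A`, killed at its
first step out of `A` — for the graph `siteGraph A` "the first `n` steps are edges" says exactly
`S_0, …, S_n ∈ A`), the squares are `ChordalLERW.unitSquare`, and simple connectivity of the finite set
`A` is the tree's combinatorial `HoleFree` ("every site outside `A` escapes to infinity outside `A`",
equivalent for finite `A` to connectedness of `ℤ² ∖ A`, Kozdron–Lawler §2.1) together with
connectedness of `A`.  The Riemann map is a predicate (`KozdronLawler.IsUnitDiscMap`), so no choice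
is made; it is inhabited by the Riemann mapping theorem
(`Complex.exists_bijOn_ball_of_isSimplyConnected`, `Literature/Analysis/Complex/RiemannMapping.lean`).
Deliberately NOT here: the proof (strong approximation of the walk by Brownian motion, KMT; Beurling
estimates; §3 of the paper), the companion Theorem 1.1 (exit probabilities against the Poisson
kernel), and the version at a general interior point `x` (eq. (22) of §3.2).

## References

* M. J. Kozdron, G. F. Lawler, Electron. J. Probab. 10 (2005) 1442–1467, arXiv:math/0501189, §1.1,
  §2.1, §2.3, Thm. 1.2 [KozdronLawler2005].
* G. F. Lawler, V. Limic, *Random Walk: A Modern Introduction*, CUP (2010), §6.2–6.3 [LawlerLimic2010].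
-/

noncomputable section

open Set Metric
open Literature.Probability.RandomPlanarGeometry (ChordalLERW.siteGraph ChordalLERW.unitSquare)

namespace Literature.Probability.LatticeModels

namespace KozdronLawler

/-- The **inradius window class `𝒜ⁿ`** of Kozdron–Lawler: finite subsets `A ⊂ ℤ²` containing the
origin, connected (through nearest-neighbour steps inside `A`) and simply connected (`HoleFree`:
every site outside `A` escapes to infinity outside `A`, i.e. `ℤ² ∖ A` is connected, §2.1), whose
inradius `inrad(A) = min{|z| : z ∈ ℤ² ∖ A}` lies in `[n, 2n]` (§1.1). [cite: KozdronLawler2005, §1.1] -/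
def IsClass (n : ℕ) (A : Finset (Site 2)) : Prop :=
  (0 : Site 2) ∈ A ∧ ((zdGraph 2).induce (↑A : Set (Site 2))).Connected ∧
    HoleFree (↑A : Set (Site 2)) ∧
    (∀ z : Site 2, z ∉ A → (n : ℝ) ≤ ‖Site.toComplex z‖) ∧
    (∃ z : Site 2, z ∉ A ∧ ‖Site.toComplex z‖ ≤ 2 * n)

/-- The **union-of-squares domain `Ã`** of a lattice set: the interior of the union of the closed
unit squares centred at the sites of `A` ("identifying each lattice point with the square of side one
centred at that point", §1.1; `ChordalLERW.unitSquare`). [cite: KozdronLawler2005, §1.1] -/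
def squareDomain (A : Finset (Site 2)) : Set ℂ :=
  interior (⋃ x ∈ A, ChordalLERW.unitSquare x)

/-- `f_A`: **a conformal transformation of `Ã` onto the unit disc with `f_A(0) = 0`, `f_A'(0) > 0`**
(§1.1), as a predicate (holomorphic on `Ã`, a bijection of `Ã` onto `𝔻`, normalised at `0`).
[cite: KozdronLawler2005, §1.1] -/
def IsUnitDiscMap (A : Finset (Site 2)) (f : ℂ → ℂ) : Prop :=
  DifferentiableOn ℂ f (squareDomain A) ∧ BijOn f (squareDomain A) (ball 0 1) ∧ f 0 = 0 ∧
    0 < (deriv f 0).re ∧ (deriv f 0).im = 0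

/-- Kozdron–Lawler's constant **`k₀ = (2ς + 3 log 2)/π`** (`ς` = Euler's constant), the constant
term of the planar potential kernel `a(x) = (2/π) log|x| + k₀ + o(1)` (§2.3).
[cite: KozdronLawler2005, §2.3] -/
def greenConst : ℝ :=
  (2 * Real.eulerMascheroniConstant + 3 * Real.log 2) / Real.pi

end KozdronLawler

/-- **Kozdron–Lawler 2005, Theorem 1.2** (named fact, unproved here): there is a constant `c` such
that for every `n ≥ 2`, every `A ∈ 𝒜ⁿ` (`KozdronLawler.IsClass n A`) and every conformal
transformation `f` of `Ã` onto the unit disc with `f(0) = 0`, `f'(0) > 0`,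
`|G_A(0,0) - (-(2/π) log f'(0) + k₀)| ≤ c · n^{-1/3} log n`, where
`G_A(0,0) = SRW.killedGreen (ChordalLERW.siteGraph A) 0 0` is the expected number of visits to the
origin (time `0` included) of simple random walk before its first exit from `A`, and
`k₀ = KozdronLawler.greenConst`.  "If `A ∈ 𝒜ⁿ`, then `G_A(0) = -(2/π) log f_A'(0) + k₀ + O(n^{-1/3} log n)`."
[cite: KozdronLawler2005, Thm. 1.2] -/
def greenFunction_origin_eq_log_conformalRadius : Prop :=
  ∃ c : ℝ, ∀ n : ℕ, 2 ≤ n → ∀ A : Finset (Site 2), KozdronLawler.IsClass n A →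
    ∀ f : ℂ → ℂ, KozdronLawler.IsUnitDiscMap A f →
      |SRW.killedGreen (ChordalLERW.siteGraph (↑A : Set (Site 2))) 0 0 -
          (-(2 / Real.pi) * Real.log ‖deriv f 0‖ + KozdronLawler.greenConst)| ≤
        c * (n : ℝ) ^ (-(1 : ℝ) / 3) * Real.log n

end Literature.Probability.LatticeModels

end
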